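import Literature.Geometry.Manifold.DiscFoldRotationIsotopy
import HarnessLib

/-!
# The fold isotopy preserves every set invariant under both flows

Family `hodge`, layer `Literature/Geometry/Manifold`; a strengthening of `DiscFoldRotationIsotopy.exists_rotationIsotopy_of_folds` with the
SAME construction `g(θ, q) = T(e^{iθ}·p q, S(p q, q))` (fold after unfold) and one more conclusion: **every set `B` invariant under both flows
`θ₁, θ₂` (for all times) is preserved by `g(θ, ·)` for every `θ`.** (`g(θ, ·)` is a composite of four flow maps.) This is what lets the fold
isotopy of the degeneration programme (`AlgebraicGeometry/HodgeTheory/CyclicCoverPencilFoldIsotopy`) preserve the level sets of the conserved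
coefficients and of the Morse radius in the shell — the inputs "g preserves ρ below R" / "g preserves the fibre structure" of
`ShellInterpolatedIsotopy`.

Everything is proved; no definitions, no named facts.

## References

* [ArnoldGuseinzadeVarchenko2012] V. I. Arnold, S. M. Gusein-Zade, A. N. Varchenko, Singularities of Differentiable Maps II (2012), Part I §1.1.
* [BrockerJanichIDT1982] T. Bröcker, K. Jänich, Introduction to Differential Topology (1982), (8.12) (proof, the fold).
-/

noncomputable section

open Set Function Complex
open scoped Real

namespace Literature.Geometry.Manifold

section FoldInvariant

variable {M : Type*} {p : M → ℂ} {θ₁ θ₂ : ℝ × M → M} {A : Set M} {δ : ℝ}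

/-- **The fold isotopy, with invariant sets.** As `DiscFoldRotationIsotopy.exists_rotationIsotopy_of_folds` (continuous `g`, `g₀ = id = g_{2π}`,
on `A` over the disc: stays in `A`, covers the rotation, flow law), and moreover every set `B ⊆ M` invariant under both flows `θ₁`, `θ₂` is
preserved by each `g(θ, ·)`. [cite: ArnoldGuseinzadeVarchenko2012, Part I §1.1 (held text p0013, p0025)]
[cite: BrockerJanichIDT1982, (8.12) (proof, the fold)] -/
theorem exists_rotationIsotopy_of_folds_invariant [TopologicalSpace M] (hp : Continuous p)
    (hθ₁ : Continuous θ₁) (h0₁ : ∀ x, θ₁ (0, x) = x) (hadd₁ : ∀ t s x, θ₁ (t, θ₁ (s, x)) = θ₁ (t + s, x))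
    (hθ₂ : Continuous θ₂) (h0₂ : ∀ x, θ₂ (0, x) = x) (hadd₂ : ∀ t s x, θ₂ (t, θ₂ (s, x)) = θ₂ (t + s, x))
    (h₁ : ∀ x ∈ A, ∀ t : ℝ, (∀ s ∈ uIcc 0 t, ‖p x + s‖ < δ) →
      ∀ s ∈ uIcc 0 t, θ₁ (s, x) ∈ A ∧ p (θ₁ (s, x)) = p x + s)
    (h₂ : ∀ x ∈ A, ∀ t : ℝ, (∀ s ∈ uIcc 0 t, ‖p x + s * I‖ < δ) →
      ∀ s ∈ uIcc 0 t, θ₂ (s, x) ∈ A ∧ p (θ₂ (s, x)) = p x + s * I) :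
    ∃ g : ℝ × M → M, Continuous g ∧ (∀ q, g (0, q) = q) ∧ (∀ q, g (2 * π, q) = q) ∧
      (∀ θ, ∀ q ∈ A, ‖p q‖ < δ → g (θ, q) ∈ A ∧ p (g (θ, q)) = Complex.exp (θ * I) * p q) ∧
      (∀ θ θ', ∀ q ∈ A, ‖p q‖ < δ → g (θ + θ', q) = g (θ, g (θ', q))) ∧
      (∀ B : Set M, (∀ s x, x ∈ B → θ₁ (s, x) ∈ B) → (∀ s x, x ∈ B → θ₂ (s, x) ∈ B) →
        ∀ θ, ∀ q ∈ B, g (θ, q) ∈ B) := by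
  -- `T c y` and `S c q` written out
  let T : ℂ → M → M := fun c y => θ₂ (c.im, θ₁ (c.re, y))
  let S : ℂ → M → M := fun c q => θ₁ (-c.re, θ₂ (-c.im, q))
  let rot : ℝ → ℂ → ℂ := fun θ c => Complex.exp (θ * I) * c
  have hrot_norm : ∀ θ c, ‖rot θ c‖ = ‖c‖ := fun θ c => by
    simp only [rot, norm_mul, Complex.norm_exp_ofReal_mul_I, one_mul]
  have hrot_zero : ∀ c, rot 0 c = c := fun c => by simp [rot]
  have hrot_add : ∀ θ θ' c, rot (θ + θ') c = rot θ (rot θ' c) := fun θ θ' c => by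
    simp only [rot, Complex.ofReal_add, add_mul, Complex.exp_add]; ring
  have hrot_two_pi : ∀ c, rot (2 * π) c = c := fun c => by
    simp only [rot]
    rw [show ((2 * π : ℝ) : ℂ) * I = 2 * π * I by push_cast; ring, Complex.exp_two_pi_mul_I, one_mul]
  refine ⟨fun θq => T (rot θq.1 (p θq.2)) (S (p θq.2) θq.2), ?_, fun q => ?_, fun q => ?_, fun θ q hq hpq => ?_,
    fun θ θ' q hq hpq => ?_, fun B hB₁ hB₂ θ q hq => ?_⟩
  · -- continuity
    have hre : Continuous fun θq : ℝ × M => (rot θq.1 (p θq.2)).re :=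
      Complex.continuous_re.comp (by
        simp only [rot]
        exact ((Complex.continuous_exp.comp ((Complex.continuous_ofReal.comp continuous_fst).mul
          continuous_const)).mul (hp.comp continuous_snd)))
    have him : Continuous fun θq : ℝ × M => (rot θq.1 (p θq.2)).im :=
      Complex.continuous_im.comp (by
        simp only [rot]
        exact ((Complex.continuous_exp.comp ((Complex.continuous_ofReal.comp continuous_fst).mul
          continuous_const)).mul (hp.comp continuous_snd)))
    have hS : Continuous fun θq : ℝ × M => S (p θq.2) θq.2 := by
      simp only [S]
      exact hθ₁.comp ((Complex.continuous_re.comp (hp.comp continuous_snd)).neg.prodMk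
        (hθ₂.comp ((Complex.continuous_im.comp (hp.comp continuous_snd)).neg.prodMk continuous_snd)))
    simp only [T]
    exact hθ₂.comp (him.prodMk (hθ₁.comp (hre.prodMk hS)))
  · -- `g 0 = id`
    show T (rot 0 (p q)) (S (p q) q) = q
    rw [hrot_zero]
    exact fold_unfold h0₁ hadd₁ h0₂ hadd₂ _ _ q
  · -- `g 2π = id`
    show T (rot (2 * π) (p q)) (S (p q) q) = q
    rw [hrot_two_pi]
    exact fold_unfold h0₁ hadd₁ h0₂ hadd₂ _ _ q
  · -- over the disc: stays in `A`, covers the rotation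
    show T (rot θ (p q)) (S (p q) q) ∈ A ∧ p (T (rot θ (p q)) (S (p q) q)) = rot θ (p q)
    obtain ⟨hS₁, hS₂⟩ := unfold_mem_and_apply_unfold h₁ h₂ hq rfl hpq
    exact fold_mem_and_apply_fold h₁ h₂ hS₁ hS₂ (by rw [hrot_norm]; exact hpq)
  · -- flow law
    show T (rot (θ + θ') (p q)) (S (p q) q) =
      T (rot θ (p (T (rot θ' (p q)) (S (p q) q)))) (S (p (T (rot θ' (p q)) (S (p q) q))) (T (rot θ' (p q)) (S (p q) q)))
    obtain ⟨hS₁, hS₂⟩ := unfold_mem_and_apply_unfold h₁ h₂ hq rfl hpq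
    obtain ⟨-, hT₂⟩ := fold_mem_and_apply_fold h₁ h₂ hS₁ hS₂ (c := rot θ' (p q)) (by rw [hrot_norm]; exact hpq)
    rw [hT₂]
    show _ = T (rot θ (rot θ' (p q))) (S (rot θ' (p q)) (T (rot θ' (p q)) (S (p q) q)))
    rw [← hrot_add]
    congr 1
    exact (unfold_fold h0₁ hadd₁ h0₂ hadd₂ _ _ _).symm

  · -- globally invariant sets are preserved
    show T (rot θ (p q)) (S (p q) q) ∈ B
    simp only [T, S]
    exact hB₂ _ _ (hB₁ _ _ (hB₁ _ _ (hB₂ _ _ hq)))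

end FoldInvariant

end Literature.Geometry.Manifold

end
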